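import Summits.HodgeConjecture.HodgeConjecture.Theorems.NikulinTwinTransportRealMultiplicationCore
import Literature.AlgebraicGeometry.HodgeTheory.HodgeIndexSurface
import Literature.AlgebraicGeometry.HodgeTheory.ComplexGysinHodgeType
import Literature.AlgebraicGeometry.HodgeTheory.HodgeFiltrationModelsReductionProofs

/-!
# Route NikulinTwinTransport · item `SquareHodgeOfSqrtTwo` (stmt-HodgeConjecture-13680) —
# the Néron–Severi / transcendental decomposition of `H²` of a marked projective K3 surface

Fifth file of the Künneth bookkeeping for `S ⊗ S`. On `V = H²(S(ℂ); ℂ)` with its cup form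
`a ∪ b = B(a,b) • p` (read through a marking `η`, `B(a,b) = (ηa.ηb)`), let `N = N¹H² =
algebraicClasses S 1` (the Néron–Severi classes) and `T = N^⊥` (the transcendental classes, the
`x` with `x ∪ d = 0` for all `d ∈ N`, as in the route items). This file proves, from the Hodge index
theorem for `S` (the tree's named fact `hodgeIndex_surface`, Hartshorne V Thm. 1.9) and the marking:

* `eq_zero_of_mem_algebraicClasses_of_orthogonal` — `N ∩ T` contains no non-zero RATIONAL class;
* `exists_mem_add_mem_of_isRationalClass` — every rational class is `n + t` with `n ∈ N`, `t ∈ T`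
  both rational (`NS(S)_ℚ ⊕ T(S)_ℚ = H²(S, ℚ)`, Huybrechts Ch. 3 §2.2 / Lemma 3.3.1: the form on
  `NS_ℚ` is non-degenerate, `restrict_nondegenerate_iff_isCompl_orthogonal` over `ℚ`);
* `exists_nsProjection` — hence `V = N ⊕ T` over `ℂ` (dimension count with the non-degenerate cup
  form) and the projection `π_N` onto `N` along `T` is a rational Hodge endomorphism (it preserves
  rational classes and Hodge types; `N ⊆ H^{1,1}`, and classes of type `≠ (1,1)` lie in `T`);
* `map_mem_algebraicClasses_of_hodgeEndo` — a rational Hodge endomorphism maps `N` into `N`,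
  GRANTED Lefschetz `(1,1)` for `S` (rational `(1,1)`-classes are algebraic);
* `exists_rankOne_of_range_le` — an endomorphism with image in `N` killing `T` is a sum of rank-one
  maps `x ↦ (x.aᵢ) bᵢ` with `aᵢ, bᵢ ∈ N` (`exists_eq_sum_rankOne` of `…RealMultiplicationCore`).

## References

* [Huybrechts2016K3] D. Huybrechts, Lectures on K3 Surfaces, CUP 2016, Ch. 1 Prop. 2.4 and §3.3,
  Ch. 3 §2.2 and Lemma 3.3.1.
* [Hartshorne1977] R. Hartshorne, Algebraic Geometry, Springer 1977, V Thm. 1.9 and Rem. 1.9.1.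
* [VoisinHodgeI2002] C. Voisin, Hodge Theory and Complex Algebraic Geometry I, CUP 2002, Lemma 7.30,
  §11.3.
-/

noncomputable section

open CategoryTheory AlgebraicGeometry MonoidalCategory CartesianMonoidalCategory
open Literature.AlgebraicGeometry.Motives Literature.AlgebraicGeometry.HodgeTheory
open Literature.AlgebraicGeometry.Surfaces
open Literature.AlgebraicTopology.SingularHomology

namespace Summit.HodgeConjecture.HodgeConjecture.Theorems.NikulinTwinTransport

/-- The complex K3 form is non-degenerate (`det Λ_{K3} = -1`). [cite: Huybrechts2016K3, Ch. 14 §0.3 (vi)] -/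
theorem k3FormC_nondegenerate : k3FormC.Nondegenerate := by
  refine LinearMap.BilinForm.nondegenerate_toBilin'_of_det_ne_zero' _ ?_
  have h : (k3Gram.map (Int.cast : ℤ → ℂ)).det = ((k3Gram.det : ℤ) : ℂ) := (Int.cast_det k3Gram).symm
  rw [h, k3Gram_det]
  norm_num

section Marked

variable {S : SchemeOver ℂ} (hK3 : IsK3Surface S)
  (η : complexBetti S (2 * 1) ≃ₗ[ℂ] (K3Index → ℂ)) {p : complexBetti S (2 * 2)} (hp0 : p ≠ 0)
  (hint : ∀ c : complexBetti S (2 * 1), IsIntegralClass c ↔ ∃ v : K3Index → ℤ, η c = fun i => (v i : ℂ))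
  (hcup : ∀ a b : complexBetti S (2 * 1),
    cupProduct (rfl : 2 * 1 + 2 * 1 = 2 * 2) a b = k3Form (η a) (η b) • p)

/-! ### The cup form read through the marking -/

/-- The cup form of `H²(S(ℂ); ℂ)` read through the marking: `(x, y) ↦ (ηx.ηy)`. [folklore] -/
theorem cupForm_apply (x y : complexBetti S (2 * 1)) :
    (k3FormC.compl₁₂ η.toLinearMap η.toLinearMap : LinearMap.BilinForm ℂ (complexBetti S (2 * 1))) x y =
      k3Form (η x) (η y) := by
  simp only [LinearMap.compl₁₂_apply, LinearEquiv.coe_coe, k3FormC_apply]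

/-- The cup form of `H²(S(ℂ); ℂ)` read through the marking is symmetric. [folklore] -/
theorem isSymm_cupForm :
    LinearMap.BilinForm.IsSymm
      (k3FormC.compl₁₂ η.toLinearMap η.toLinearMap : LinearMap.BilinForm ℂ (complexBetti S (2 * 1))) :=
  ⟨fun x y ↦ by simp only [cupForm_apply, k3Form_comm]⟩

/-- The cup form of `H²(S(ℂ); ℂ)` read through the marking is non-degenerate.
[cite: Huybrechts2016K3, Ch. 14 §0.3 (vi)] -/
theorem nondegenerate_cupForm :
    LinearMap.BilinForm.Nondegenerate
      (k3FormC.compl₁₂ η.toLinearMap η.toLinearMap : LinearMap.BilinForm ℂ (complexBetti S (2 * 1))) := by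
  refine (LinearMap.IsRefl.nondegenerate_iff_separatingLeft (isSymm_cupForm η).isRefl).2 fun x hx ↦ ?_
  have h : η x = 0 := by
    refine (LinearMap.IsRefl.nondegenerate_iff_separatingLeft k3FormC_isSymm.isRefl).1
      k3FormC_nondegenerate (η x) fun w ↦ ?_
    have := hx (η.symm w)
    rwa [cupForm_apply, LinearEquiv.apply_symm_apply, ← k3FormC_apply] at this
  simpa using h

include hp0 hcup in
/-- Membership in the orthogonal of `N = algebraicClasses S 1` for the marked cup form is the route's
transcendence condition `∀ d ∈ N, x ∪ d = 0`. [folklore] -/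
theorem mem_orthogonal_iff (x : complexBetti S (2 * 1)) :
    x ∈ LinearMap.BilinForm.orthogonal
        (k3FormC.compl₁₂ η.toLinearMap η.toLinearMap : LinearMap.BilinForm ℂ (complexBetti S (2 * 1)))
        (algebraicClasses S 1) ↔
      ∀ d ∈ algebraicClasses S 1, cupProduct (rfl : 2 * 1 + 2 * 1 = 2 * 2) x d = 0 := by
  rw [LinearMap.BilinForm.mem_orthogonal_iff]
  refine forall₂_congr fun d _ ↦ ?_
  rw [cupForm_apply, hcup, k3Form_comm, smul_eq_zero, or_iff_left hp0]

/-! ### Hodge index: no rational class is both algebraic and transcendental -/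

include hK3 in
/-- **`NS(S)_ℚ ∩ T(S)_ℚ = 0`**: a rational class of `N = N¹H²` orthogonal to all of `N` is zero — by
the Hodge index theorem (`hodgeIndex_surface`: the primitive rational algebraic classes have
`c ∪ c ≠ 0`) such a class is orthogonal to the ample class and to itself.
[cite: Hartshorne1977, V Thm. 1.9 and Rem. 1.9.1] [cite: Huybrechts2016K3, Ch. 1 Prop. 2.4] -/
theorem eq_zero_of_mem_algebraicClasses_of_orthogonal (hHI : hodgeIndex_surface S)
    {d : complexBetti S (2 * 1)} (hdN : d ∈ algebraicClasses S 1) (hdr : IsRationalClass d)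
    (hdT : ∀ d' ∈ algebraicClasses S 1, cupProduct (rfl : 2 * 1 + 2 * 1 = 2 * 2) d d' = 0) : d = 0 := by
  obtain ⟨h, -, -, hhN, -, hidx⟩ := hHI hK3.isSmoothProjective
  by_contra hd0
  exact hidx d hdr hdN (hdT h hhN) hd0 (hdT d hdN)

/-! ### The rational decomposition `H²(S, ℚ) = NS_ℚ ⊕ T_ℚ` -/

include hK3 hint hcup in
/-- **Every rational class is the sum of a rational algebraic class and a rational transcendental
class** (`H²(S, ℚ) = NS(S)_ℚ ⊕ T(S)_ℚ`): read through the marking, the rational points `N_ℚ` of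
`N` form a subspace of `Λ_ℚ` on which the K3 form is non-degenerate
(`eq_zero_of_mem_algebraicClasses_of_orthogonal`, `N` being spanned by its rational classes), so
`Λ_ℚ = N_ℚ ⊕ N_ℚ^⊥` (`restrict_nondegenerate_iff_isCompl_orthogonal`), and `η⁻¹(N_ℚ^⊥) ⊆ T`.
[cite: Huybrechts2016K3, Ch. 3 §2.2 and Lemma 3.3.1] -/
theorem exists_mem_add_mem_of_isRationalClass (hHI : hodgeIndex_surface S)
    {x : complexBetti S (2 * 1)} (hx : IsRationalClass x) :
    ∃ n t : complexBetti S (2 * 1), n ∈ algebraicClasses S 1 ∧ IsRationalClass n ∧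
      (∀ d ∈ algebraicClasses S 1, cupProduct (rfl : 2 * 1 + 2 * 1 = 2 * 2) t d = 0) ∧
      IsRationalClass t ∧ x = n + t := by
  classical
  set N := algebraicClasses S 1 with hNdef
  -- the rational points of `N`
  let NQ : Submodule ℚ (K3Index → ℚ) :=
    { carrier := {u | η.symm (fun j => (u j : ℂ)) ∈ N}
      add_mem' := fun {u v} hu hv => by
        simp only [Set.mem_setOf_eq, ratCastΛ_add, map_add]
        exact N.add_mem hu hv
      zero_mem' := by
        simp only [Set.mem_setOf_eq, ratCastΛ_zero, map_zero]
        exact N.zero_mem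
      smul_mem' := fun q u hu => by
        simp only [Set.mem_setOf_eq, ratCastΛ_smul, map_smul]
        exact N.smul_mem _ hu }
  have memNQ : ∀ u, u ∈ NQ ↔ η.symm (fun j => (u j : ℂ)) ∈ N := fun u => Iff.rfl
  -- `N` is spanned by its rational classes, so `N_ℚ^⊥ ⊗ ℂ ⊆ N^⊥`
  have hspan := span_isRationalClass_eq_top_of_isSmoothProjective_holds.supportedClasses_eq_span
    hK3.isSmoothProjective (2 * 1) 1
  have horth : ∀ u ∈ k3FormRat.orthogonal NQ, ∀ d ∈ N, k3Form (fun j => (u j : ℂ)) (η d) = 0 := by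
    intro u hu d hd
    rw [LinearMap.BilinForm.mem_orthogonal_iff] at hu
    have hd' : d ∈ Submodule.span ℂ {c : complexBetti S (2 * 1) |
        IsRationalClass c ∧ c ∈ supportedClasses S (2 * 1) 1} := by
      rw [← hspan]; exact hd
    clear hd
    induction hd' using Submodule.span_induction with
    | mem d hd =>
      obtain ⟨w, hw⟩ := (isRationalClass_iff_of_marking hK3 η hint d).1 hd.1
      have hwN : w ∈ NQ := by
        rw [memNQ, ← hw, LinearEquiv.symm_apply_apply]
        exact hd.2
      rw [hw, k3Form_ratCast, k3FormRat_isSymm.eq, hu w hwN, Rat.cast_zero]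
    | zero => rw [map_zero, k3Form_zero_right]
    | add c c' _ _ hc hc' => rw [map_add, k3Form_add_right, hc, hc', add_zero]
    | smul t c _ hc => rw [map_smul, k3Form_smul_right, hc, mul_zero]
  -- the form is non-degenerate on `N_ℚ` (Hodge index)
  have hNQ : (k3FormRat.restrict NQ).Nondegenerate := by
    refine LinearMap.BilinForm.Nondegenerate.ofSeparatingLeft ?_
    rintro ⟨u, hu⟩ h
    have huT : u ∈ k3FormRat.orthogonal NQ := by
      rw [LinearMap.BilinForm.mem_orthogonal_iff]
      intro w hw
      rw [k3FormRat_isSymm.eq]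
      exact h ⟨w, hw⟩
    have hd0 : η.symm (fun j => (u j : ℂ)) = 0 := by
      refine eq_zero_of_mem_algebraicClasses_of_orthogonal hK3 hHI ((memNQ u).1 hu)
        ((isRationalClass_iff_of_marking hK3 η hint _).2 ⟨u, η.apply_symm_apply _⟩) fun d hd ↦ ?_
      rw [hcup, LinearEquiv.apply_symm_apply, horth u huT d hd, zero_smul]
    have hu0 : (fun j => (u j : ℂ)) = 0 := by simpa using congrArg η hd0
    exact Subtype.ext (ratCastΛ_injective (hu0.trans ratCastΛ_zero.symm))
  have hc : IsCompl NQ (k3FormRat.orthogonal NQ) :=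
    (LinearMap.BilinForm.restrict_nondegenerate_iff_isCompl_orthogonal k3FormRat_isSymm.isRefl).1 hNQ
  -- decompose `η x = y + z`
  obtain ⟨w, hw⟩ := (isRationalClass_iff_of_marking hK3 η hint x).1 hx
  obtain ⟨y, hy, z, hz, hyz⟩ := Submodule.mem_sup.1 (hc.sup_eq_top.symm ▸ Submodule.mem_top (x := w))
  refine ⟨η.symm (fun j => (y j : ℂ)), η.symm (fun j => (z j : ℂ)), (memNQ y).1 hy,
    (isRationalClass_iff_of_marking hK3 η hint _).2 ⟨y, η.apply_symm_apply _⟩, fun d hd ↦ ?_,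
    (isRationalClass_iff_of_marking hK3 η hint _).2 ⟨z, η.apply_symm_apply _⟩, ?_⟩
  · rw [hcup, LinearEquiv.apply_symm_apply, horth z hz d hd, zero_smul]
  · apply η.injective
    rw [map_add, η.apply_symm_apply, η.apply_symm_apply, hw, ← ratCastΛ_add, hyz]

/-! ### `V = N ⊕ T` over `ℂ`, and the projection onto `N` -/

include hK3 hp0 hint hcup in
/-- **`H²(S(ℂ); ℂ) = N ⊕ T` and the projection `π_N` is a rational Hodge endomorphism.** From the
rational decomposition every basis class `η⁻¹ eₖ` lies in `N + T`, so `N + T = V`; the cup form being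
non-degenerate, `dim N + dim T = dim V` (`LinearMap.BilinForm.finrank_orthogonal`), so `N ∩ T = 0`.
The projection `π` onto `N` along `T` then maps rational classes to rational classes (uniqueness of
the decomposition `x = n + t`), classes of type `(1,1)` to classes of type `(1,1)` (`N ⊆ H^{1,1}`),
and kills the classes of type `≠ (1,1)`, which lie in `T` (`x ∪ d` has type `≠ (2,2)` for `d ∈ N`).
[cite: Huybrechts2016K3, Ch. 3 §2.2 and Lemma 3.3.1] [cite: VoisinHodgeI2002, Lemma 7.30] -/
theorem exists_nsProjection (hHI : hodgeIndex_surface S) (A : HodgeModel 2 S)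
    (hcupS : CupPreservesHodgeType 2 S)
    (hN11 : ∀ d ∈ algebraicClasses S 1, IsOfHodgeType 2 S (2 * 1) 1 1 d) :
    ∃ π : complexBetti S (2 * 1) →ₗ[ℂ] complexBetti S (2 * 1),
      (∀ x, π x ∈ algebraicClasses S 1) ∧
      (∀ d ∈ algebraicClasses S 1, π d = d) ∧
      (∀ t, (∀ d ∈ algebraicClasses S 1, cupProduct (rfl : 2 * 1 + 2 * 1 = 2 * 2) t d = 0) → π t = 0) ∧
      (∀ x, ∀ d ∈ algebraicClasses S 1, cupProduct (rfl : 2 * 1 + 2 * 1 = 2 * 2) (x - π x) d = 0) ∧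
      (∀ x, IsRationalClass x → IsRationalClass (π x)) ∧
      (∀ (i j : ℕ) x, IsOfHodgeType 2 S (2 * 1) i j x →
        IsOfHodgeType 2 S (2 * 1) i j (π x) ∧ IsOfHodgeType 2 S (2 * 1) i j (x - π x)) := by
  have hI := hodgePQ_independent_of_hodgeModel_holds
  have hS := hK3.isSmoothProjective
  haveI : FiniteDimensional ℂ (complexBetti S (2 * 1)) := LinearEquiv.finiteDimensional η.symm
  set N : Submodule ℂ (complexBetti S (2 * 1)) := algebraicClasses S 1 with hNdef
  set Bf : LinearMap.BilinForm ℂ (complexBetti S (2 * 1)) :=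
    k3FormC.compl₁₂ η.toLinearMap η.toLinearMap with hBf
  set T : Submodule ℂ (complexBetti S (2 * 1)) := Bf.orthogonal N with hTdef
  have memT : ∀ x, x ∈ T ↔ ∀ d ∈ N, cupProduct (rfl : 2 * 1 + 2 * 1 = 2 * 2) x d = 0 :=
    mem_orthogonal_iff η hp0 hcup
  -- `N + T = V`: every basis class `η⁻¹ eₖ` decomposes
  have hsup : N ⊔ T = ⊤ := by
    rw [eq_top_iff, ← (((Pi.basisFun ℂ K3Index).map η.symm).span_eq), Submodule.span_le]
    rintro _ ⟨k, rfl⟩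
    have hk : IsRationalClass (((Pi.basisFun ℂ K3Index).map η.symm) k) := by
      rw [Module.Basis.map_apply, basisFun_eq_ratCastΛ]
      exact (isRationalClass_iff_of_marking hK3 η hint _).2 ⟨_, η.apply_symm_apply _⟩
    obtain ⟨n, t, hn, -, ht, -, hnt⟩ := exists_mem_add_mem_of_isRationalClass hK3 η hint hcup hHI hk
    rw [SetLike.mem_coe, hnt]
    exact Submodule.add_mem_sup hn ((memT t).2 ht)
  -- `dim N + dim T = dim V`, hence `N ∩ T = 0`
  have hinf : N ⊓ T = ⊥ := by
    have h1 := Submodule.finrank_sup_add_finrank_inf_eq N T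
    rw [hsup, finrank_top] at h1
    have h2 : Module.finrank ℂ N + Module.finrank ℂ T = Module.finrank ℂ (complexBetti S (2 * 1)) := by
      have := LinearMap.BilinForm.finrank_add_finrank_orthogonal (isSymm_cupForm η).isRefl N
      rwa [LinearMap.BilinForm.orthogonal_top_eq_bot (nondegenerate_cupForm η), inf_bot_eq, finrank_bot,
        add_zero] at this
    refine Submodule.finrank_eq_zero.1 ?_
    omega
  have hc : IsCompl N T := IsCompl.of_eq hinf hsup
  refine ⟨N.projection T hc, fun x ↦ Submodule.projection_apply_mem hc x,
    fun d hd ↦ Submodule.projection_apply_of_mem_left hc hd,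
    fun t ht ↦ (Submodule.projection_apply_eq_zero_iff hc).2 ((memT t).2 ht),
    fun x ↦ (memT _).1 (Submodule.sub_projection_mem hc x), fun x hx ↦ ?_, fun i j x hx ↦ ?_⟩
  · -- rationality: `x = n + t` with `n`, `t` rational
    obtain ⟨n, t, hn, hnr, ht, -, rfl⟩ := exists_mem_add_mem_of_isRationalClass hK3 η hint hcup hHI hx
    rw [map_add, Submodule.projection_apply_of_mem_left hc hn,
      (Submodule.projection_apply_eq_zero_iff hc).2 ((memT t).2 ht), add_zero]
    exact hnr
  · by_cases hij : i = 1 ∧ j = 1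
    · obtain ⟨rfl, rfl⟩ := hij
      have h1 : IsOfHodgeType 2 S (2 * 1) 1 1 (N.projection T hc x) :=
        hN11 _ (Submodule.projection_apply_mem hc x)
      refine ⟨h1, ?_⟩
      rw [hI.isOfHodgeType_iff hS A] at hx h1 ⊢
      rw [map_sub]
      exact Submodule.sub_mem _ hx h1
    · -- classes of type `≠ (1,1)` are transcendental
      have hxT : x ∈ T := by
        rw [memT]
        intro d hd
        exact cupProduct_eq_zero_of_hodgeType hI hS A hcupS (rfl : 2 * 1 + 2 * 1 = 2 * 2)
          (by omega) ((hI.isOfHodgeType_iff hS A).1 hx) ((hI.isOfHodgeType_iff hS A).1 (hN11 d hd))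
      have h0 : N.projection T hc x = 0 := (Submodule.projection_apply_eq_zero_iff hc).2 hxT
      rw [h0, sub_zero]
      exact ⟨IsOfHodgeType.zero A _ _ _, hx⟩

/-! ### Rational Hodge endomorphisms preserve `N` (Lefschetz `(1,1)`) -/

include hK3 in
/-- **A rational Hodge endomorphism of `H²(S(ℂ); ℂ)` maps `N = N¹H²` into itself**, GRANTED
Lefschetz `(1,1)` for `S` (`hL11`: rational `(1,1)`-classes are algebraic) and `N ⊆ H^{1,1}` (`hN11`):
`N` is spanned by its rational classes, whose images are rational of type `(1,1)`.
[cite: VoisinHodgeI2002, §11.3 (Thm. 11.30)] -/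
theorem map_mem_algebraicClasses_of_hodgeEndo
    (hL11 : ∀ c : complexBetti S (2 * 1), IsRationalClass c → IsOfHodgeType 2 S (2 * 1) 1 1 c →
      c ∈ algebraicClasses S 1)
    (hN11 : ∀ d ∈ algebraicClasses S 1, IsOfHodgeType 2 S (2 * 1) 1 1 d)
    (f : complexBetti S (2 * 1) →ₗ[ℂ] complexBetti S (2 * 1))
    (hfr : ∀ x, IsRationalClass x → IsRationalClass (f x))
    (hft : ∀ x, IsOfHodgeType 2 S (2 * 1) 1 1 x → IsOfHodgeType 2 S (2 * 1) 1 1 (f x))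
    {d : complexBetti S (2 * 1)} (hd : d ∈ algebraicClasses S 1) : f d ∈ algebraicClasses S 1 := by
  have hspan := span_isRationalClass_eq_top_of_isSmoothProjective_holds.supportedClasses_eq_span
    hK3.isSmoothProjective (2 * 1) 1
  have hd' : d ∈ Submodule.span ℂ {c : complexBetti S (2 * 1) |
      IsRationalClass c ∧ c ∈ supportedClasses S (2 * 1) 1} := by
    rw [← hspan]; exact hd
  clear hd
  induction hd' using Submodule.span_induction with
  | mem c hc => exact hL11 _ (hfr c hc.1) (hft c (hN11 c hc.2))
  | zero => rw [map_zero]; exact Submodule.zero_mem _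
  | add c c' _ _ hc hc' => rw [map_add]; exact Submodule.add_mem _ hc hc'
  | smul t c _ hc => rw [map_smul]; exact Submodule.smul_mem _ _ hc

/-! ### Endomorphisms with image in `N` killing `T` are sums of products of divisors -/

include hp0 hcup in
/-- **An endomorphism `G` of `H²(S(ℂ); ℂ)` with image in `N` and killing `T` is a finite sum of
rank-one maps `x ↦ (ηx.ηaᵢ) bᵢ` with `aᵢ, bᵢ ∈ N`** (`exists_eq_sum_rankOne` for the marked cup form).
[cite: Huybrechts2019, §1] -/
theorem exists_rankOne_of_range_le (G : complexBetti S (2 * 1) →ₗ[ℂ] complexBetti S (2 * 1))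
    (hGN : ∀ x, G x ∈ algebraicClasses S 1)
    (hGT : ∀ t, (∀ d ∈ algebraicClasses S 1, cupProduct (rfl : 2 * 1 + 2 * 1 = 2 * 2) t d = 0) → G t = 0) :
    ∃ (m : ℕ) (a b : Fin m → complexBetti S (2 * 1)),
      (∀ i, a i ∈ algebraicClasses S 1) ∧ (∀ i, b i ∈ algebraicClasses S 1) ∧
      ∀ x, G x = ∑ i, k3Form (η x) (η (a i)) • b i := by
  haveI : FiniteDimensional ℂ (complexBetti S (2 * 1)) := LinearEquiv.finiteDimensional η.symm
  obtain ⟨m, a, b, ha, hb, hG⟩ := exists_eq_sum_rankOne (isSymm_cupForm η) (nondegenerate_cupForm η)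
    (algebraicClasses S 1) G hGN fun t ht ↦ hGT t ((mem_orthogonal_iff η hp0 hcup t).1 ht)
  refine ⟨m, a, b, ha, hb, fun x ↦ ?_⟩
  rw [hG x]
  exact Finset.sum_congr rfl fun i _ ↦ by rw [cupForm_apply]

end Marked

end Summit.HodgeConjecture.HodgeConjecture.Theorems.NikulinTwinTransport

end
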